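import Mathlib.Algebra.MvPolynomial.Funext
import Mathlib.Algebra.Order.Field.Basic
import Mathlib.Algebra.Order.Field.Rat
import Mathlib.LinearAlgebra.Basis.VectorSpace
import Mathlib.LinearAlgebra.Dual.Lemmas
import Mathlib.Order.Interval.Set.Infinite
import HarnessLib

/-!
# `PentagonInKZ`, line `logfree-gauge-corner-flatness`: stub `polyIdentity_of_eval`

Stub `polyIdentity_of_eval` of the crux `PentagonInKZ` (stmt-KontsevichZagierPeriods-11348, route
FurushoPentagon): the polynomial identity principle with module coefficients. A finite combination
`∑ᵢ Pᵢ(x, y) • vᵢ` (`Pᵢ ∈ ℚ[x, y]`, `vᵢ` in a `ℚ`-module `M`) that vanishes at every rational point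
of a nonempty open box `(a, b) × (c, d)` has all its monomial coefficients `∑ᵢ coeff_μ(Pᵢ) • vᵢ`
equal to `0`. The lead uses it to turn pointwise algebraic identities between connection
coefficients (rational functions of `(x, y)` on an open rectangle) into coefficientwise identities,
which can then be integrated against arbitrary kernels.

Proof.
* Scalar case (`eq_zero_of_aeval_box`): a polynomial `Q ∈ ℚ[x, y]` vanishing on the rational points
  of the box is zero, by `MvPolynomial.funext_set` applied to the box `![Ioo a b, Ioo c d]`, whose
  sides are infinite (`Set.Ioo_infinite`, `ℚ` densely ordered).
* Module case: by `Module.forall_dual_apply_eq_zero_iff` (every `ℚ`-module is free, hence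
  projective) it suffices to show `φ (∑ᵢ coeff_μ(Pᵢ) • vᵢ) = 0` for every linear functional
  `φ : M →ₗ[ℚ] ℚ`; this number is `coeff_μ` of the scalar polynomial `Q_φ := ∑ᵢ φ(vᵢ) • Pᵢ`, whose
  evaluations on the box are `φ` applied to the hypothesis, hence zero; so `Q_φ = 0`.

References: folklore (identity theorem for polynomials over an infinite field).
-/

namespace Summit.KontsevichZagierPeriods.FurushoPentagon.PentagonInKZ

namespace PolyIdentity

/-- Scalar polynomial identity principle on a box: a polynomial `Q ∈ ℚ[x, y]` that vanishes at
every rational point of a nonempty open box `(a, b) × (c, d)` is the zero polynomial. [folklore] -/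
theorem eq_zero_of_aeval_box (Q : MvPolynomial (Fin 2) ℚ) {a b c d : ℚ} (hab : a < b)
    (hcd : c < d)
    (h : ∀ x y : ℚ, a < x → x < b → c < y → y < d → MvPolynomial.aeval ![x, y] Q = 0) :
    Q = 0 := by
  refine MvPolynomial.funext_set (p := Q) (q := 0) ![Set.Ioo a b, Set.Ioo c d] ?_ ?_
  · intro i
    fin_cases i
    · exact Set.Ioo_infinite hab
    · exact Set.Ioo_infinite hcd
  · intro x hx
    have h0 := hx 0 (Set.mem_univ _)
    have h1 := hx 1 (Set.mem_univ _)
    simp only [Matrix.cons_val_zero, Matrix.cons_val_one, Set.mem_Ioo] at h0 h1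
    have hx' : x = ![x 0, x 1] := by
      ext i
      fin_cases i <;> rfl
    rw [map_zero, hx']
    exact h _ _ h0.1 h0.2 h1.1 h1.2

/-- Linear functionals pass through module-valued polynomial combinations: applying
`φ : M →ₗ[ℚ] ℚ` to `∑ᵢ Pᵢ(x, y) • vᵢ` gives the evaluation at `(x, y)` of the scalar polynomial
`∑ᵢ φ(vᵢ) • Pᵢ`. [folklore] -/
theorem dual_apply_sum_aeval_smul {M : Type} [AddCommGroup M] [Module ℚ M] {ι : Type}
    [Fintype ι] (P : ι → MvPolynomial (Fin 2) ℚ) (v : ι → M) (φ : Module.Dual ℚ M)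
    (x y : ℚ) :
    φ (∑ i, (MvPolynomial.aeval ![x, y] (P i)) • v i) =
      MvPolynomial.aeval ![x, y] (∑ i, φ (v i) • P i) := by
  rw [map_sum, map_sum]
  refine Finset.sum_congr rfl fun i _ => ?_
  rw [map_smul, map_smul, smul_eq_mul, smul_eq_mul, mul_comm]

/-- Linear functionals pass through module-valued coefficient combinations: applying
`φ : M →ₗ[ℚ] ℚ` to `∑ᵢ coeff_μ(Pᵢ) • vᵢ` gives `coeff_μ` of the scalar polynomial `∑ᵢ φ(vᵢ) • Pᵢ`.
[folklore] -/
theorem dual_apply_sum_coeff_smul {M : Type} [AddCommGroup M] [Module ℚ M] {ι : Type}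
    [Fintype ι] (P : ι → MvPolynomial (Fin 2) ℚ) (v : ι → M) (φ : Module.Dual ℚ M)
    (μ : Fin 2 →₀ ℕ) :
    φ (∑ i, (MvPolynomial.coeff μ (P i)) • v i) =
      MvPolynomial.coeff μ (∑ i, φ (v i) • P i) := by
  rw [map_sum, MvPolynomial.coeff_sum]
  refine Finset.sum_congr rfl fun i _ => ?_
  rw [map_smul, MvPolynomial.coeff_smul, smul_eq_mul, smul_eq_mul, mul_comm]

end PolyIdentity

/-- **Polynomial identity principle with module coefficients.** If a finite combination
`∑ᵢ Pᵢ(x, y) • vᵢ` of bivariate rational polynomials `Pᵢ` with coefficients `vᵢ` in a `ℚ`-module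
`M` vanishes at every rational point of a nonempty open box `(a, b) × (c, d)`, then every monomial
coefficient `∑ᵢ coeff_μ(Pᵢ) • vᵢ` vanishes. [folklore] -/
theorem polyIdentity_of_eval : ∀ (M : Type) [AddCommGroup M] [Module ℚ M] (ι : Type) [Fintype ι] (P : ι → MvPolynomial (Fin 2) ℚ) (v : ι → M) (a b c d : ℚ), a < b → c < d → (∀ x y : ℚ, a < x → x < b → c < y → y < d → ∑ i, (MvPolynomial.aeval ![x, y] (P i)) • v i = 0) → ∀ μ : Fin 2 →₀ ℕ, ∑ i, (MvPolynomial.coeff μ (P i)) • v i = 0 := by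
  intro M _ _ ι _ P v a b c d hab hcd h μ
  refine (Module.forall_dual_apply_eq_zero_iff ℚ _).mp fun φ => ?_
  have hQ : (∑ i, φ (v i) • P i) = 0 := by
    refine PolyIdentity.eq_zero_of_aeval_box _ hab hcd fun x y hax hxb hcy hyd => ?_
    rw [← PolyIdentity.dual_apply_sum_aeval_smul P v φ x y, h x y hax hxb hcy hyd, map_zero]
  rw [PolyIdentity.dual_apply_sum_coeff_smul P v φ μ, hQ, MvPolynomial.coeff_zero]

end Summit.KontsevichZagierPeriods.FurushoPentagon.PentagonInKZ
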